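import Summits.Ventures.YMGap.RobustBall.LangevinPoincare
import Summits.Ventures.YMGap.Thresholds.SharpPoincare
import Summits.Ventures.YMGap.Thresholds.OneLinkModulusSU3Twisted
import Literature.MathematicalPhysics.QuantumFieldTheory.Balaban1983to89.StrongCouplingKernelWindow
import HarnessLib

/-!
# Robust ball (Y2) — the Langevin Poincaré inequality on the Kantorovich–Rubinstein window: LIPSCHITZ FORM, CELLS, and EVERY INFINITE-VOLUME LIMIT

HONEST FRAMING: venture file of the cell `pub-ymgap` (QuantumFields programme), track ROBUST-BALL, seat rb-p2 (g13); companion of `LangevinPoincare.lean`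
(★★★ `variance_le_integral_Gam_of_oneLinkKRModulus`: `Var_{μ_{β,L}}(f) ≤ ((1 − c)K₀)⁻¹ ∫ Γ(f,f) dμ_{β,L}` on every torus of side `≥ 2`, `d = 4`).
LATTICE statements at STRONG COUPLING, Wilson action (class K); nothing about `β → ∞`, the continuum or Clay.  This file:
* `variance_le_sum_sq_of_oneLinkKRModulus` — the LIPSCHITZ form (Shen–Zhu–Zhu Cor. 4.4 (4.12) currency = the venture's `LatticeBakryEmery.torus_variance_le`):
  `Var_{μ_{β,L}}(f) ≤ ((1 − c)K₀)⁻¹ ∑_e L_e²` for a smooth `f` that is `L_e`-Lipschitz in the link `e` (Frobenius distance); ★★★ `su2_variance_le_sum_sq`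
  (`SU(2)`, `0 ≤ β_W < 2/9`, constant `((1 − 9β_W/2)(1 − 3β_W))⁻¹`).
* `suN_variance_le_integral_Gam_bakryEmery` — EVERY `SU(N)`, `N ≥ 2`, HYPOTHESIS-FREE via the tree's Bakry–Émery one-link modulus on 't Hooft `0 ≤ b < 1/48`
  (SZZ's printed window): closed form `(N(1/2 − 24b))⁻¹` — HONEST: no gain in window over the Bakry–Émery route here (`1/48 < 1/32`); it is the
  discrete-route closed form for the record.  ★★ `su3_variance_le_integral_Gam_pv2t` — `SU(3)`, HYPOTHESIS-FREE on `0 ≤ β_W < 1000/3531 ≈ 0.2832` (engine-2's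
  certified TWISTED modulus `OneLinkKRModulus 3 (1/5) (3531/2000)`), constant `((1 − 3531β_W/1000)(3/2 − 2β_W))⁻¹` — the Bakry–Émery window for `SU(3)` is
  `β_W < 9/32 = 0.28125`: larger by a hair.
* ★★★ `variance_le_of_mem_infiniteVolumeLimitPoints_of_torus` + `su2_limit_variance_le_sum_sq` — the passage to EVERY infinite-volume (tight) limit state
  (the variance clause of SZZ Cor. 4.5 (4.13)): for `SU(2)`, `0 ≤ β_W < 2/9`, every `μ ∈ infiniteVolumeLimitPoints χ₂ (β_W/2)` and every smooth cylinder
  function `F = f((U_e)_{e∈Λ})` that is `L_e`-Lipschitz in the link `e`, `Var_μ(F) ≤ ((1 − 9β_W/2)(1 − 3β_W))⁻¹ ∑_e L_e²` (the venture's Bakry–Émery version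
  `LatticeBakryEmery.variance_le_of_mem_infiniteVolumeLimitPoints` has `(1 − 8β_W)⁻¹` on `β_W < 1/8`).  The limit passage is the venture's (p2, `SharpPoincare`)
  argument verbatim, abstracted over the torus bound.
0 sorry, 0 definitions.  References: H. Shen, R. Zhu, X. Zhu, CMP 400 (2023) 805–851, Cor. 4.4 (4.12), Cor. 4.5 (4.13); L. Wu, Ann. Probab. 34 (2006) 1960.
Everything here is proved. [folklore]
-/

noncomputable section

open scoped Matrix ComplexConjugate BigOperators Matrix.Norms.Frobenius ContDiff Topology ProbabilityTheory
open Matrix Complex Finset MeasureTheory Filter ProbabilityTheory Function Real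
open Literature.MathematicalPhysics.QuantumFieldTheory
open Literature.MathematicalPhysics.QuantumLattice (fundamentalRep continuous_fundamentalRep
  torusEdge torusLift toTorusObservable infiniteVolumeLimitPoints IsInfiniteVolumeLimitAlong IsCylinder)
open Literature.MathematicalPhysics.QuantumFieldTheory.SUNBakryEmery (SUN FrameIdx frame)
open Literature.MathematicalPhysics.QuantumFieldTheory.Balaban1983to89.StrongCouplingDobrushinWindow (OneLinkKRModulus)
open Summit.Ventures.YMGap.LatticeBakryEmery

namespace Summit.Ventures.YMGap.RobustBall.LangevinPoincare

universe u

/-! ### The Lipschitz form on the torus -/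

section Torus

variable {N L : ℕ} [NeZero L]

/-- **Langevin Poincaré inequality, Lipschitz form** (Shen–Zhu–Zhu Cor. 4.4 (4.12) currency, on the Kantorovich–Rubinstein window): under the hypotheses of
`variance_le_integral_Gam_of_oneLinkKRModulus`, for a smooth `f` of the link matrices that is `L_e`-Lipschitz in the link `e` (Frobenius distance),
`Var_{μ_{β,L}}(f) ≤ ((1 − c)K₀)⁻¹ ∑_e L_e²` on every torus of side `≥ 2`. [folklore] -/
theorem variance_le_sum_sq_of_oneLinkKRModulus (hN : 1 ≤ N) {β R K c : ℝ} (hK : 0 ≤ K) (hR : |β| / N * 6 ≤ R)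
    (hmod : OneLinkKRModulus N R K) (hc : 18 * (|β| / N) * K ≤ c) (hc1 : c < 1) (hK₀ : 0 < (N : ℝ) / 2 - 6 * |β|)
    (hL : 1 < L) {f : Cfg (Edge 4 L) N → ℝ} (hf : ContDiff ℝ ∞ f) {Lc : Edge 4 L → ℝ} (hL0 : ∀ e, 0 ≤ Lc e)
    (hLip : LinkLipschitz f Lc) :
    Var[fun U => f (emb U); wilsonMeasure (d := 4) (L := L) (fundamentalRep (Fin N)) β] ≤
      ((1 - c) * ((N : ℝ) / 2 - 6 * |β|))⁻¹ * ∑ e, Lc e ^ 2 := by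
  haveI := isProbabilityMeasure_wilsonMeasure (d := 4) (L := L) (fundamentalRep (Fin N)) (continuous_fundamentalRep (Fin N)) β
  refine (variance_le_integral_Gam_of_oneLinkKRModulus hN hK hR hmod hc hc1 hK₀ hL hf).trans
    (mul_le_mul_of_nonneg_left ?_ (inv_nonneg.2 (mul_nonneg (by linarith) hK₀.le)))
  calc ∫ U, Gam f f (emb U) ∂(wilsonMeasure (d := 4) (L := L) (fundamentalRep (Fin N)) β)
      ≤ ∫ _U, ∑ e, Lc e ^ 2 ∂(wilsonMeasure (d := 4) (L := L) (fundamentalRep (Fin N)) β) :=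
        integral_mono (integrable_of_continuous_PSU (continuous_restrict (contDiff_Gam hf hf)) _) (integrable_const _)
          fun U => Gam_le_of_linkLipschitz (by omega) hf hL0 hLip U
    _ = ∑ e, Lc e ^ 2 := by simp

/-- ★★★ **`SU(2)`, `d = 4`, HYPOTHESIS-FREE, LIPSCHITZ FORM on `0 ≤ β_W < 2/9`**: on every torus of side `≥ 2`, for a smooth `f` that is `L_e`-Lipschitz in the
link `e`, `Var_μ(f) ≤ ((1 − 9β_W/2)(1 − 3β_W))⁻¹ ∑_e L_e²` (the venture's Bakry–Émery `torus_variance_le`: `(1 − 8β_W)⁻¹` on `β_W < 1/8`). [folklore] -/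
theorem su2_variance_le_sum_sq {βW : ℝ} (h0 : 0 ≤ βW) (h : βW < 2 / 9) (hL : 1 < L) {f : Cfg (Edge 4 L) 2 → ℝ} (hf : ContDiff ℝ ∞ f)
    {Lc : Edge 4 L → ℝ} (hL0 : ∀ e, 0 ≤ Lc e) (hLip : LinkLipschitz f Lc) :
    Var[fun U => f (emb U); wilsonMeasure (d := 4) (L := L) (fundamentalRep (Fin 2)) (βW / 2)] ≤
      ((1 - 9 * βW / 2) * (1 - 3 * βW))⁻¹ * ∑ e, Lc e ^ 2 := by
  have habs : |βW / 2| = βW / 2 := abs_of_nonneg (by positivity)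
  have key := variance_le_sum_sq_of_oneLinkKRModulus (N := 2) (L := L) (by norm_num) (β := βW / 2) zero_le_one
    (R := 3 * βW / 2) (by rw [habs]; push_cast; linarith) (SlabAreaLawDimensions.su2_oneLinkKRModulus_of_le_one (by linarith))
    (c := 9 * βW / 2) (by rw [habs]; push_cast; linarith) (by linarith) (by rw [habs]; push_cast; linarith) hL hf hL0 hLip
  have e : ((2 : ℕ) : ℝ) / 2 - 6 * |βW / 2| = 1 - 3 * βW := by rw [habs]; push_cast; ring
  rw [e] at key
  exact key

/-- **EVERY `SU(N)`, `N ≥ 2`, HYPOTHESIS-FREE (Bakry–Émery one-link modulus `K = 1/(1/2 − 6b)`) on Shen–Zhu–Zhu's printed window 't Hooft `0 ≤ b < 1/48`**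
(tree coupling `N b`): `Var_μ(f) ≤ (N(1/2 − 24b))⁻¹ ∫ Γ(f,f) dμ` on every torus of side `≥ 2` — the discrete-route closed form; no gain in window over the
Bakry–Émery route (`(N(1/2 − 16b))⁻¹` on `|b| < 1/32`) for general `N`. [folklore] -/
theorem suN_variance_le_integral_Gam_bakryEmery (hN : 2 ≤ N) {b : ℝ} (hb0 : 0 ≤ b) (hb : b < 1 / 48) (hL : 1 < L)
    {f : Cfg (Edge 4 L) N → ℝ} (hf : ContDiff ℝ ∞ f) :
    Var[fun U => f (emb U); wilsonMeasure (d := 4) (L := L) (fundamentalRep (Fin N)) ((N : ℝ) * b)] ≤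
      ((N : ℝ) * (1 / 2 - 24 * b))⁻¹ * ∫ U, Gam f f (emb U) ∂(wilsonMeasure (d := 4) (L := L) (fundamentalRep (Fin N)) ((N : ℝ) * b)) := by
  have hN0 : (0 : ℝ) < N := by exact_mod_cast (show 0 < N by omega)
  have habs : |(N : ℝ) * b| = N * b := abs_of_nonneg (by positivity)
  have habs' : |(N : ℝ) * b| / N = b := by rw [habs]; field_simp
  have hden : 0 < 1 / 2 - 6 * b := by linarith
  have hc1 : 18 * b / (1 / 2 - 6 * b) < 1 := by rw [div_lt_one hden]; linarith
  have hK₀ : 0 < (N : ℝ) / 2 - 6 * |(N : ℝ) * b| := by rw [habs]; nlinarith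
  have key := variance_le_integral_Gam_of_oneLinkKRModulus (N := N) (L := L) (by omega) (β := (N : ℝ) * b) (K := 1 / (1 / 2 - 6 * b))
    (by positivity) (R := 6 * b) (by rw [habs']; linarith) (Balaban1983to89.StrongCouplingKernelWindow.oneLinkKRModulus_SU hN (by linarith))
    (c := 18 * b / (1 / 2 - 6 * b)) (by rw [habs']; exact le_of_eq (by field_simp)) hc1 hK₀ hL hf
  have e : (1 - 18 * b / (1 / 2 - 6 * b)) * ((N : ℝ) / 2 - 6 * |(N : ℝ) * b|) = N * (1 / 2 - 24 * b) := by
    rw [habs, show (N : ℝ) / 2 - 6 * (N * b) = N * (1 / 2 - 6 * b) by ring, sub_mul, one_mul, div_mul_eq_mul_div,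
      show 18 * b * ((N : ℝ) * (1 / 2 - 6 * b)) = 18 * b * N * (1 / 2 - 6 * b) by ring, mul_div_assoc, div_self hden.ne', mul_one]
    ring
  rw [e] at key
  exact key

/-- ★★ **`SU(3)`, `d = 4`, HYPOTHESIS-FREE (engine-2's certified TWISTED modulus `OneLinkKRModulus 3 (1/5) (3531/2000)`) on `0 ≤ β_W < 1000/3531 ≈ 0.2832`**
(tree coupling `β_W/3`): `Var_μ(f) ≤ ((1 − 3531β_W/1000)(3/2 − 2β_W))⁻¹ ∫ Γ(f,f) dμ` on every torus of side `≥ 2` — the Bakry–Émery window for `SU(3)` is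
`β_W < 9/32 = 0.28125` (venture `SharpPoincare`; Shen–Zhu–Zhu: `9/48`): the twisted KR window is larger by a hair. [folklore] -/
theorem su3_variance_le_integral_Gam_pv2t {βW : ℝ} (h0 : 0 ≤ βW) (h : βW < 1000 / 3531) (hL : 1 < L) {f : Cfg (Edge 4 L) 3 → ℝ}
    (hf : ContDiff ℝ ∞ f) :
    Var[fun U => f (emb U); wilsonMeasure (d := 4) (L := L) (fundamentalRep (Fin 3)) (βW / 3)] ≤
      ((1 - 3531 * βW / 1000) * (3 / 2 - 2 * βW))⁻¹ * ∫ U, Gam f f (emb U) ∂(wilsonMeasure (d := 4) (L := L) (fundamentalRep (Fin 3)) (βW / 3)) := by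
  have habs : |βW / 3| = βW / 3 := abs_of_nonneg (by positivity)
  have habs' : |βW / 3| / ((3 : ℕ) : ℝ) = βW / 9 := by rw [habs]; push_cast; ring
  have key := variance_le_integral_Gam_of_oneLinkKRModulus (N := 3) (L := L) (by norm_num) (β := βW / 3) (by norm_num) (R := 1 / 5)
    (by rw [habs']; linarith) TwistedBochner.su3_oneLinkKRModulus_pv2t_oneFifth (c := 3531 * βW / 1000)
    (by rw [habs']; linarith) (by linarith) (by rw [habs]; push_cast; linarith) hL hf
  have e : ((3 : ℕ) : ℝ) / 2 - 6 * |βW / 3| = 3 / 2 - 2 * βW := by rw [habs]; push_cast; ring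
  rw [e] at key
  exact key

end Torus

/-! ### Passage to every infinite-volume (tight) limit -/

section Limits

variable {N : ℕ}

/-- **From a volume-uniform torus Poincaré inequality (Lipschitz form) to every infinite-volume limit** (the venture's `SharpPoincare` argument, abstracted
over the torus bound): if on every torus of side `≥ 2` every smooth per-link-Lipschitz `g` satisfies `Var_{μ_{β,L}}(g) ≤ C ∑_e L_e²`, then every tight limit
`μ` of the torus states at tree coupling `β` satisfies `Var_μ(F) ≤ C ∑_e L_e²` for every smooth cylinder function `F = f((U_e)_{e∈Λ})` that is `L_e`-Lipschitz
in the link `e`. [folklore] -/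
theorem variance_le_of_mem_infiniteVolumeLimitPoints_of_torus {β C : ℝ}
    (htorus : ∀ (L : ℕ) [NeZero L], 1 < L → ∀ {g : Cfg (Edge 4 L) N → ℝ}, ContDiff ℝ ∞ g → ∀ {Lt : Edge 4 L → ℝ},
      (∀ e, 0 ≤ Lt e) → LinkLipschitz g Lt → Var[fun U => g (emb U); wilsonMeasure (d := 4) (L := L) (fundamentalRep (Fin N)) β] ≤ C * ∑ e, Lt e ^ 2)
    {μ : Measure (Literature.MathematicalPhysics.QuantumLattice.LGConfig 4 (Matrix.specialUnitaryGroup (Fin N) ℂ))}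
    (hμ : μ ∈ infiniteVolumeLimitPoints (d := 4) (fundamentalRep (Fin N)) β)
    (Λ : Finset (ZdEdge 4)) (f : (↥Λ → Matrix (Fin N) (Fin N) ℂ) → ℝ) (Lc : ↥Λ → ℝ)
    (hf : ContDiff ℝ ∞ f) (hL : ∀ e, 0 ≤ Lc e)
    (hLip : ∀ (e : ↥Λ) (M M' : ↥Λ → Matrix.specialUnitaryGroup (Fin N) ℂ),
      (∀ e', e' ≠ e → M e' = M' e') →
        |f (fun e' => (M e' : Matrix (Fin N) (Fin N) ℂ)) - f (fun e' => (M' e' : Matrix (Fin N) (Fin N) ℂ))|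
          ≤ Lc e * suFrobDist (M e) (M' e)) :
    Var[matrixCylinder Λ f; μ] ≤ C * ∑ e, Lc e ^ 2 := by
  obtain ⟨Ls, hLs, hprob, hlim⟩ := hμ
  haveI := hprob
  set F : Literature.MathematicalPhysics.QuantumLattice.LGConfig 4 (Matrix.specialUnitaryGroup (Fin N) ℂ) → ℝ :=
    matrixCylinder Λ f with hF
  -- `F` is a bounded continuous cylinder function, and so is `F²`
  have hFcyl : IsCylinder F Λ := isCylinder_matrixCylinder Λ f
  have hFc : Continuous F := by
    refine hf.continuous.comp ?_
    exact continuous_pi fun e => continuous_subtype_val.comp (continuous_apply _)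
  obtain ⟨C₀, hC⟩ : ∃ C₀, ∀ U, |F U| ≤ C₀ := by
    obtain ⟨C₀, hC⟩ := (isCompact_univ (X := Literature.MathematicalPhysics.QuantumLattice.LGConfig 4
      (Matrix.specialUnitaryGroup (Fin N) ℂ))).exists_bound_of_continuousOn hFc.continuousOn
    exact ⟨C₀, fun U => by simpa [Real.norm_eq_abs] using hC U (Set.mem_univ _)⟩
  have hF2cyl : IsCylinder (fun U => F U ^ 2) Λ := fun U V hUV => by
    show F U ^ 2 = F V ^ 2
    rw [hFcyl hUV]
  have ht1 := hlim F Λ hFcyl hFc ⟨C₀, hC⟩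
  have ht2 := hlim (fun U => F U ^ 2) Λ hF2cyl (hFc.pow 2) ⟨C₀ ^ 2, fun U => by
    rw [abs_pow]; exact pow_le_pow_left₀ (abs_nonneg _) (hC U) 2⟩
  -- the variance of `μ` as a limit of torus variances
  have hmem : MemLp F 2 μ := MemLp.of_bound hFc.aestronglyMeasurable C₀ (ae_of_all _ fun U => by
    rw [Real.norm_eq_abs]; exact hC U)
  have hvarμ : Var[F; μ] = (∫ U, F U ^ 2 ∂μ) - (∫ U, F U ∂μ) ^ 2 := by
    rw [variance_eq_sub hmem]
    rfl
  have htv : Tendsto (fun k => wilsonExpectation (L := Ls k + 1) (fundamentalRep (Fin N)) β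
        (toTorusObservable (Ls k + 1) fun U => F U ^ 2) -
      wilsonExpectation (L := Ls k + 1) (fundamentalRep (Fin N)) β (toTorusObservable (Ls k + 1) F) ^ 2)
      atTop (𝓝 (Var[F; μ])) := by
    rw [hvarμ]
    exact ht2.sub (ht1.pow 2)
  -- the torus variances are eventually bounded by `C ∑ L_e²`
  have h2 : Tendsto (fun k => Ls k + 1) atTop atTop :=
    tendsto_atTop_mono (fun k => Nat.le_succ (Ls k)) hLs.tendsto_atTop
  have hev : ∀ᶠ k : ℕ in atTop,
      wilsonExpectation (L := Ls k + 1) (fundamentalRep (Fin N)) β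
          (toTorusObservable (Ls k + 1) fun U => F U ^ 2) -
        wilsonExpectation (L := Ls k + 1) (fundamentalRep (Fin N)) β (toTorusObservable (Ls k + 1) F) ^ 2
        ≤ C * ∑ e, Lc e ^ 2 := by
    have hinj : ∀ᶠ k : ℕ in atTop, Set.InjOn (torusEdge (d := 4) (Ls k + 1)) ↑Λ :=
      h2.eventually (LatticeBakryEmery.eventually_injOn_torusEdge (d := 4) Λ)
    have hge : ∀ᶠ k : ℕ in atTop, 1 < Ls k + 1 := h2.eventually (eventually_gt_atTop 1)
    refine (hinj.and hge).mono fun k hk => ?_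
    obtain ⟨hk, hk1⟩ := hk
    set L' : ℕ := Ls k + 1 with hL'
    -- the cylinder function on the torus `Λ_{L'}` as a function of ALL torus links
    set g : Cfg (Edge 4 L') N → ℝ := fun Q => f fun e : ↥Λ => Q (torusEdge L' (e : ZdEdge 4)) with hg
    have hgc : ContDiff ℝ ∞ g := by
      refine hf.comp ?_
      exact contDiff_pi.2 fun e => contDiff_apply ℝ _ (torusEdge L' (e : ZdEdge 4))
    -- its per-torus-link Lipschitz constants
    set Lt : Edge 4 L' → ℝ := fun e' => ∑ e : ↥Λ, if torusEdge L' (e : ZdEdge 4) = e' then Lc e else 0 with hLt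
    have hLt0 : ∀ e', 0 ≤ Lt e' := fun e' => sum_nonneg fun e _ => by
      split_ifs
      · exact hL e
      · exact le_rfl
    have huniq : ∀ {e' : Edge 4 L'} {e₀ : ↥Λ}, torusEdge L' (e₀ : ZdEdge 4) = e' → ∀ e : ↥Λ, e ≠ e₀ → torusEdge L' (e : ZdEdge 4) ≠ e' :=
      fun {e'} {e₀} he₀ e hne hEq => hne (Subtype.ext (hk e.2 e₀.2 (hEq.trans he₀.symm)))
    have hLipg : LinkLipschitz g Lt := by
      intro e' a b hab
      by_cases hex : ∃ e₀ : ↥Λ, torusEdge L' (e₀ : ZdEdge 4) = e'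
      · obtain ⟨e₀, he₀⟩ := hex
        have hLt' : Lt e' = Lc e₀ := by
          simp only [hLt]
          rw [Finset.sum_eq_single e₀]
          · rw [if_pos he₀]
          · intro e _ hne; rw [if_neg (huniq he₀ e hne)]
          · intro h; exact absurd (mem_univ _) h
        have hdiff := hLip e₀ (fun e => a (torusEdge L' (e : ZdEdge 4))) (fun e => b (torusEdge L' (e : ZdEdge 4)))
          (fun e hne => hab _ (huniq he₀ e hne))
        rw [hLt']
        simpa [hg, emb, he₀] using hdiff
      · push Not at hex
        have hsame : (fun e : ↥Λ => emb a (torusEdge L' (e : ZdEdge 4))) = fun e : ↥Λ => emb b (torusEdge L' (e : ZdEdge 4)) := by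
          funext e
          simp only [emb_apply]
          rw [hab _ (hex e)]
        have h0 : g (emb a) - g (emb b) = 0 := by
          simp only [hg]
          rw [show (fun e : ↥Λ => emb a (torusEdge L' (e : ZdEdge 4))) = fun e : ↥Λ => emb b (torusEdge L' (e : ZdEdge 4))
            from hsame, sub_self]
        rw [h0, abs_zero]
        exact mul_nonneg (hLt0 e') (suFrobDist_nonneg _ _)
    -- `∑_{e'} Lt_{e'}² = ∑_e Lc_e²` by injectivity
    have hsumLt : ∑ e', Lt e' ^ 2 = ∑ e : ↥Λ, Lc e ^ 2 := by
      have hsq : ∀ e', Lt e' ^ 2 = ∑ e : ↥Λ, if torusEdge L' (e : ZdEdge 4) = e' then Lc e ^ 2 else 0 := by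
        intro e'
        by_cases hex : ∃ e₀ : ↥Λ, torusEdge L' (e₀ : ZdEdge 4) = e'
        · obtain ⟨e₀, he₀⟩ := hex
          simp only [hLt]
          rw [Finset.sum_eq_single e₀, Finset.sum_eq_single e₀, if_pos he₀, if_pos he₀]
          · intro e _ hne; rw [if_neg (huniq he₀ e hne)]
          · intro h; exact absurd (mem_univ _) h
          · intro e _ hne; rw [if_neg (huniq he₀ e hne)]
          · intro h; exact absurd (mem_univ _) h
        · push Not at hex
          simp only [hLt]
          rw [Finset.sum_eq_zero fun e _ => if_neg (hex e), Finset.sum_eq_zero fun e _ => if_neg (hex e)]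
          ring
      simp_rw [hsq]
      rw [Finset.sum_comm]
      refine sum_congr rfl fun e _ => ?_
      rw [Finset.sum_ite_eq univ (torusEdge L' (e : ZdEdge 4)) (fun _ => Lc e ^ 2)]
      simp
    -- the torus variance bound
    have hT := htorus L' hk1 hgc hLt0 hLipg
    rw [hsumLt] at hT
    -- identify the torus variance with the Wilson expectations of `F², F`
    haveI := isProbabilityMeasure_wilsonMeasure (d := 4) (L := L') (fundamentalRep (Fin N)) (continuous_fundamentalRep (n := Fin N)) β
    have hgF : (fun U : PSU (Edge 4 L') N => g (emb U)) = toTorusObservable L' F := by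
      funext U; rfl
    have hgc' : Continuous fun U : PSU (Edge 4 L') N => g (emb U) := continuous_restrict hgc
    have hmemk : MemLp (fun U : PSU (Edge 4 L') N => g (emb U)) 2 (wilsonMeasure (d := 4) (L := L') (fundamentalRep (Fin N)) β) :=
      MemLp.of_bound hgc'.aestronglyMeasurable C₀ (ae_of_all _ fun U => by
        rw [Real.norm_eq_abs]; exact hC (torusLift L' U))
    have hvk : Var[fun U : PSU (Edge 4 L') N => g (emb U); wilsonMeasure (d := 4) (L := L') (fundamentalRep (Fin N)) β] =
        wilsonExpectation (L := L') (fundamentalRep (Fin N)) β (toTorusObservable L' fun U => F U ^ 2) -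
          wilsonExpectation (L := L') (fundamentalRep (Fin N)) β (toTorusObservable L' F) ^ 2 := by
      rw [variance_eq_sub hmemk, hgF]
      rfl
    rw [← hvk]
    exact hT
  exact le_of_tendsto htv hev

/-- ★★★ **`SU(2)`, `d = 4`, HYPOTHESIS-FREE: THE LANGEVIN POINCARÉ INEQUALITY FOR EVERY INFINITE-VOLUME LIMIT STATE ON `0 ≤ β_W < 2/9`** (the variance
clause of Shen–Zhu–Zhu Cor. 4.5 (4.13) on the Kantorovich–Rubinstein window; tree coupling `β_W/2`): for every tight limit `μ` of the torus Wilson states and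
every smooth cylinder function `F = f((U_e)_{e∈Λ})` that is `L_e`-Lipschitz in the link `e` (Frobenius distance),
`Var_μ(F) ≤ ((1 − 9β_W/2)(1 − 3β_W))⁻¹ ∑_e L_e²` (the venture's Bakry–Émery version: `(1 − 8β_W)⁻¹` on `β_W < 1/8`). [folklore] -/
theorem su2_limit_variance_le_sum_sq {βW : ℝ} (h0 : 0 ≤ βW) (h : βW < 2 / 9)
    {μ : Measure (Literature.MathematicalPhysics.QuantumLattice.LGConfig 4 (Matrix.specialUnitaryGroup (Fin 2) ℂ))}
    (hμ : μ ∈ infiniteVolumeLimitPoints (d := 4) (fundamentalRep (Fin 2)) (βW / 2))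
    (Λ : Finset (ZdEdge 4)) (f : (↥Λ → Matrix (Fin 2) (Fin 2) ℂ) → ℝ) (Lc : ↥Λ → ℝ)
    (hf : ContDiff ℝ ∞ f) (hL : ∀ e, 0 ≤ Lc e)
    (hLip : ∀ (e : ↥Λ) (M M' : ↥Λ → Matrix.specialUnitaryGroup (Fin 2) ℂ),
      (∀ e', e' ≠ e → M e' = M' e') →
        |f (fun e' => (M e' : Matrix (Fin 2) (Fin 2) ℂ)) - f (fun e' => (M' e' : Matrix (Fin 2) (Fin 2) ℂ))| ≤ Lc e * suFrobDist (M e) (M' e)) :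
    Var[matrixCylinder Λ f; μ] ≤ ((1 - 9 * βW / 2) * (1 - 3 * βW))⁻¹ * ∑ e, Lc e ^ 2 :=
  variance_le_of_mem_infiniteVolumeLimitPoints_of_torus
    (fun L _ hL => fun hg => fun hLt0 hLipg => su2_variance_le_sum_sq (L := L) h0 h hL hg hLt0 hLipg) hμ Λ f Lc hf hL hLip

end Limits

end Summit.Ventures.YMGap.RobustBall.LangevinPoincare

end
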